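/-
Origin: expansion seat `planner-pub-hodgecm-toy2-g2-0`, handover 2026-08-18 (`HOME/pub-hodgecm-toy2-g2/lean/Toy2g2/SexticField.lean`, md5 f2027059, 124 lines);
landed by the gen-6 packager in gate run 22 as `HodgeCM/Model/SexticCM/SexticField.lean` (import ^import Toy2g2\.→import HodgeCM.Model.SexticCM. ×1).
-/
/-
Copyright: pub-hodgecm formalisation cell (harness21, 2026). New file (not vendored).
Origin: HOME/pub-hodgecm-toy2-g2/lean/Toy2g2/SexticField.lean (WIP module `Toy2g2.SexticField`; intended final place
`HodgeCM/Model/SexticCM/SexticField.lean` = module `HodgeCM.Model.SexticCM.SexticField`, CONTRIBUTING §3 L5) (seat planner-pub-hodgecm-toy2-g2-0,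
consistency seat 2 gen 2, part (6a)(ii): PerL's hypotheses are inhabited — K is a CM field (totally imaginary quadratic over the totally real cubic F = Q(beta_0))).
-/
import Summits.HodgeConjecture.HodgeCM.Model.SexticCM.Sextic

/-!
# The sextic CM field `K = ℚ(δ₀)`: number field, embeddings, totally complex, CM
-/

open Polynomial IntermediateField NumberField

noncomputable section

namespace HodgeCM.SexticCM

/-- (Ported verbatim from the HodgeCMPerL package; no docstring in the source.) -/
instance instNumberFieldK : NumberField K := NumberField.of_module_finite ℚ K

/-- the generator `δ₀` as an element of `K` -/
def δ0K : K := AdjoinSimple.gen ℚ (δ 0)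

/-- (Ported verbatim from the HodgeCMPerL package; no docstring in the source.) -/
@[simp] lemma coe_δ0K : ((δ0K : K) : ℂ) = δ 0 := rfl

/-- (Ported verbatim from the HodgeCMPerL package; no docstring in the source.) -/
lemma δ0K_rel : (δ0K : K) ^ 6 + 6 * δ0K ^ 4 + 8 * δ0K ^ 2 + 1 = 0 := by
  apply (algebraMap K ℂ).injective
  simp only [map_add, map_mul, map_pow, map_ofNat, map_one, map_zero,
    IntermediateField.algebraMap_apply, coe_δ0K]
  have h := aeval_δ 0
  rwa [aeval_mκ] at h

/-- Every embedding `K →+* ℂ` sends `δ₀` to some `±δ_m`. -/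
lemma emb_δ0K (φ : K →+* ℂ) : ∃ m, φ δ0K = δ m ∨ φ δ0K = -δ m := by
  have h := congrArg φ δ0K_rel
  simp only [map_add, map_mul, map_pow, map_ofNat, map_one, map_zero] at h
  rw [← aeval_mκ] at h
  exact (aeval_mκ_eq_zero_iff _).mp h

/-- (Ported verbatim from the HodgeCMPerL package; no docstring in the source.) -/
lemma emb_δ0K_not_real (φ : K →+* ℂ) : (starRingEnd ℂ) (φ δ0K) ≠ φ δ0K := by
  obtain ⟨m, h | h⟩ := emb_δ0K φ <;> rw [h]
  · rw [conj_δ]; exact fun e => δ_ne_neg m m e.symm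
  · rw [map_neg, conj_δ, neg_neg]; exact δ_ne_neg m m

/-- (Ported verbatim from the HodgeCMPerL package; no docstring in the source.) -/
instance instIsTotallyComplexK : IsTotallyComplex K where
  isComplex w := by
    rw [← InfinitePlace.not_isReal_iff_isComplex, ← InfinitePlace.mk_embedding w,
      InfinitePlace.isReal_mk_iff, ComplexEmbedding.isReal_iff]
    intro h
    exact emb_δ0K_not_real w.embedding (by rw [← ComplexEmbedding.conjugate_coe_eq, h])

/-! ### The totally real cubic subfield `F = ℚ(b)` -/

/-- `F = ℚ(b)`, `b = 2 - α₀`. -/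
def F : IntermediateField ℚ ℂ := ℚ⟮((β 0 : ℝ) : ℂ)⟯

/-- (Ported verbatim from the HodgeCMPerL package; no docstring in the source.) -/
lemma F_le_K : F ≤ K := Qb_le_K

/-- (Ported verbatim from the HodgeCMPerL package; no docstring in the source.) -/
def bF : F := AdjoinSimple.gen ℚ ((β 0 : ℝ) : ℂ)

/-- (Ported verbatim from the HodgeCMPerL package; no docstring in the source.) -/
@[simp] lemma coe_bF : ((bF : F) : ℂ) = ((β 0 : ℝ) : ℂ) := rfl

/-- (Ported verbatim from the HodgeCMPerL package; no docstring in the source.) -/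
lemma g3_prod (x : ℂ) : x ^ 3 - 6 * x ^ 2 + 8 * x - 1 =
    (x - ((β 0 : ℝ) : ℂ)) * (x - ((β 1 : ℝ) : ℂ)) * (x - ((β 2 : ℝ) : ℂ)) := by
  obtain ⟨h1, h2, h3⟩ := vietaC
  simp only [β, Complex.ofReal_sub, Complex.ofReal_ofNat]
  linear_combination (-(x - 2) ^ 2) * h1 - (x - 2) * h2 - h3

/-- (Ported verbatim from the HodgeCMPerL package; no docstring in the source.) -/
lemma bF_rel : (bF : F) ^ 3 - 6 * bF ^ 2 + 8 * bF - 1 = 0 := by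
  apply (algebraMap F ℂ).injective
  simp only [map_sub, map_add, map_mul, map_pow, map_ofNat, map_one, map_zero,
    IntermediateField.algebraMap_apply, coe_bF]
  have h := aeval_b_g3
  simpa only [g3, map_sub, map_add, map_mul, map_pow, aeval_X, map_one, map_ofNat] using h

/-- (Ported verbatim from the HodgeCMPerL package; no docstring in the source.) -/
lemma emb_bF (ψ : F →+* ℂ) : ∃ k, ψ bF = ((β k : ℝ) : ℂ) := by
  have h := congrArg ψ bF_rel
  simp only [map_sub, map_add, map_mul, map_pow, map_ofNat, map_one, map_zero] at h
  rw [g3_prod] at h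
  simp only [mul_eq_zero, sub_eq_zero] at h
  rcases h with (h | h) | h
  exacts [⟨0, h⟩, ⟨1, h⟩, ⟨2, h⟩]

/-- (Ported verbatim from the HodgeCMPerL package; no docstring in the source.) -/
lemma emb_F_real (ψ : F →+* ℂ) : ComplexEmbedding.IsReal ψ := by
  rw [ComplexEmbedding.isReal_iff]
  suffices h : (ComplexEmbedding.conjugate ψ).toRatAlgHom = ψ.toRatAlgHom by
    have := congrArg AlgHom.toRingHom h
    simpa using this
  apply adjoin_algHom_ext ℚ
  intro x hx
  simp only [Set.mem_singleton_iff] at hx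
  subst hx
  change (ComplexEmbedding.conjugate ψ) bF = ψ bF
  obtain ⟨k, hk⟩ := emb_bF ψ
  rw [ComplexEmbedding.conjugate_coe_eq, hk, Complex.conj_ofReal]

/-- (Ported verbatim from the HodgeCMPerL package; no docstring in the source.) -/
instance instNumberFieldF : NumberField F := by
  haveI : FiniteDimensional ℚ F := adjoin.finiteDimensional isIntegral_b
  exact NumberField.of_module_finite ℚ F

/-- (Ported verbatim from the HodgeCMPerL package; no docstring in the source.) -/
instance instIsTotallyRealF : IsTotallyReal F where
  isReal w := by
    rw [← InfinitePlace.mk_embedding w, InfinitePlace.isReal_mk_iff]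
    exact emb_F_real _

/-! ### `K / F` is a CM extension -/

/-- (Ported verbatim from the HodgeCMPerL package; no docstring in the source.) -/
instance algFK : Algebra F K := (IntermediateField.inclusion F_le_K).toRingHom.toAlgebra

/-- (Ported verbatim from the HodgeCMPerL package; no docstring in the source.) -/
instance istFK : IsScalarTower ℚ F K := IsScalarTower.of_algebraMap_eq fun _ => rfl

/-- (Ported verbatim from the HodgeCMPerL package; no docstring in the source.) -/
lemma finrank_F : Module.finrank ℚ F = 3 := finrank_Qb

/-- (Ported verbatim from the HodgeCMPerL package; no docstring in the source.) -/
lemma finrank_FK : Module.finrank F K = 2 := by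
  have h := Module.finrank_mul_finrank ℚ F K
  rw [finrank_F, finrank_K] at h
  omega

/-- (Ported verbatim from the HodgeCMPerL package; no docstring in the source.) -/
instance instIsQuadraticExtensionFK : Algebra.IsQuadraticExtension F K where
  finrank_eq_two' := finrank_FK

/-- (Ported verbatim from the HodgeCMPerL package; no docstring in the source.) -/
instance instIsCMFieldK : IsCMField K := IsCMField.ofCMExtension F K

end HodgeCM.SexticCM
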